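import Summits.FinalStateConjecture.FinalStateConjecture.Theorems.ClusterCompletenessAdiabaticMultiKerrILEDWeightedTCurrent
import Summits.FinalStateConjecture.FinalStateConjecture.Theorems.ClusterCompletenessAdiabaticMultiKerrILEDWeightedTEnergyGraph
import Summits.FinalStateConjecture.FinalStateConjecture.Theorems.ClusterCompletenessAdiabaticMultiKerrILEDRestFrameFarEnergyBound
import Summits.FinalStateConjecture.FinalStateConjecture.Theorems.ClusterCompletenessAdiabaticMultiKerrILEDTailsCutPullbackWave
import Summits.FinalStateConjecture.FinalStateConjecture.Theorems.ClusterCompletenessAdiabaticMultiKerrILEDSingleZoneFarEnergyBoundZeroSpin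

/-!
# Crux `AdiabaticMultiKerrILED`, line `Sketch`: the far-energy bound for ONE tails-cut zone of ZERO SPIN,
# closed form (lead c7, composition of waves 1–2)

Crux item `stmt-FinalStateConjecture-14310`
(`Summit.FinalStateConjecture.FinalStateConjecture.Theses.ClusterCompleteness.AdiabaticMultiKerrILED`).
The research stub `stub_farEnergyBound_pos` (FB) of skeleton v9 asks, for `N ≥ 1` boosted tails-cut slowly
rotating Kerr zones, that the lab energy on `{rᵢ ≥ r₊ᵢ + ηMᵢ}` stay bounded by `C·E[ψ](0)` at late times.
This file closes its **single-zone, zero-spin instance** (the `a = 0` case of the child crux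
`SingleZoneFarEnergyBound` of the route-level split), with NO hypotheses:

* `restFrame_farEnergyBound` — rest frame, tilted leaves `{x⁰ = s + F(x⃗)}` with `‖∇F‖ ≤ 1/2`: for the
  tails-cut Schwarzschild coefficient field `G₀ = η − σ(2 − r/8M)·(2M/r) ℓ♯⊗ℓ♯` and every `C²` solution of
  `□_{G₀} Φ = 0` on `{F(x⃗) ≤ x⁰} ∩ {r > 2M}`,
  `∫_{leaf s ∩ {r ≥ (2+η)M}} Σ(∂Φ)² ≤ C(η) ∫_{leaf 0 ∩ {r > 2M}} Σ(∂Φ)²` for all `s ≥ 0` — composed from the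
  pointwise weighted Killing-current facts (`sum_fderiv_weightedTCurrent_nonneg`, `contDiff_weightedTCurrent`,
  p158990: zero bulk of `J^T`, dominant-energy signs of the receding horizon factor and of the backward cones),
  the weighted graph energy inequality (`weightedTEnergy_graph_le`, p159693) and the assembly with limits
  (`restFrame_farEnergyBound_of_weighted`, p160649: coercivity `tEnergy_leafFlux_coercive` p156712 off the collar,
  `A → ∞`, `ε → 0` by monotone convergence);
* `singleZoneFarEnergyBound_zeroSpin` — the lab statement in the crux's own vocabulary (`Fin 1` configuration,
  boost of speed `≤ v₀ = 1/2`, patched field, exterior energy functional `E`): `∀ η > 0 ∃ t₁ C ∀ ψ …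
  ∫_{x⁰ = t, r ≥ r₊ + ηM} Σ(∂ψ)² ≤ C·E[ψ](0)` for `t ≥ t₁` — by the lab transport
  (`singleZoneFarEnergyBound_zeroSpin_of_rest`, p161639: slice–leaf correspondence p127675) applied to the Poincaré
  pull-back (`tailsCut_pullbackWave_single`, p161099) and `restFrame_farEnergyBound`.

What remains of FB after this: spin `0 < |a| ≤ αM` at `N = 1` (superradiant boundedness for the tails-cut zone)
and `N ≥ 2` (the Doppler budget of strict recession). Dafermos–Rodnianski, arXiv:0811.0354, §3 (the `T`-energy
and the dominant energy condition); DRSR arXiv:1402.7034, §2.3.2.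
-/

noncomputable section

-- the doubled `FinalStateConjecture.FinalStateConjecture` path component trips dupNamespace
set_option linter.dupNamespace false

open scoped ContDiff Topology BigOperators ENNReal InnerProductSpace
open Filter Set MeasureTheory Literature.Geometry.Lorentzian

namespace Summit.FinalStateConjecture.FinalStateConjecture.Theorems

/-- **Far-energy bound for the zero-spin tails-cut zone, rest frame, tilted leaves.** For `M > 0`, `η > 0`
there is `C` such that for every `C²` height `F` of slope `≤ 1/2` and every `C²` solution `Φ` of the tails-cut
Schwarzschild wave equation on `{F(x⃗) ≤ x⁰} ∩ {r > 2M}`, the coordinate energy through the leaf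
`{x⁰ = s + F(x⃗)}` restricted to `{r ≥ (2 + η)M}` is at most `C` times the energy through the initial leaf
outside the horizon, for all `s ≥ 0` (Killing `T`-energy, receding horizon factor, backward cones, dominant
energy condition, coercivity off the collar). [cite: DafermosRodnianski2008, §3] -/
theorem restFrame_farEnergyBound : ∀ (M η : ℝ), 0 < M → 0 < η → ∃ C : NNReal, ∀ (F : E3 → ℝ) (Φ : E4 → ℝ), ContDiff ℝ 2 F → (∀ y, ‖fderiv ℝ F y‖ ≤ 2⁻¹) → ContDiff ℝ 2 Φ → (∀ x : E4, F (E4.spatial x) ≤ x 0 → 2 * M < Kerr.radius 0 x → KerrSchild.waveOperator (KerrSchild.inverseMetric (fun y ↦ Real.smoothTransition (2 - Kerr.radius 0 y / (8 * M)) * (2 * Kerr.scalarH M 0 y)) (Kerr.nullVector 0)) Φ x = 0) → ∀ s : ℝ, 0 ≤ s → ∫⁻ y in {y : E3 | (2 + η) * M ≤ Kerr.radius 0 (E4.ofTimeSpace (s + F y) y)}, ENNReal.ofReal (∑ μ : Fin 4, (fderiv ℝ Φ (E4.ofTimeSpace (s + F y) y) (E4.basisVector μ)) ^ 2) ≤ (C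 : ENNReal) * ∫⁻ y in {y : E3 | 2 * M < Kerr.radius 0 (E4.ofTimeSpace (0 + F y) y)}, ENNReal.ofReal (∑ μ : Fin 4, (fderiv ℝ Φ (E4.ofTimeSpace (0 + F y) y) (E4.basisVector μ)) ^ 2) := by
  intro M η hM hη
  obtain ⟨C, hC⟩ := restFrame_farEnergyBound_of_weighted M η hM hη
  refine ⟨C, fun F Φ hF hslope hΦ hsol s hs ↦ hC F Φ hF hslope hΦ ?_ s hs⟩
  intro ε A c s' hε hs' hA
  refine weightedTEnergy_graph_le M ε A c F Φ s' hM hε hF hslope hs' hA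
    (contDiff_weightedTCurrent M ε A c Φ hM hε hΦ) ?_
  intro x hFx _hxs hr hxA
  exact sum_fderiv_weightedTCurrent_nonneg M ε A c Φ x hM hε hxA hr (hΦ.contDiffAt) (hsol x hFx hr)

/-- **Far-energy bound for one boosted tails-cut zone of zero spin, lab foliation** (the `N = 1`, `a = 0`
instance of stub `stub_farEnergyBound_pos` of line `Sketch`, closed form): there is `v₀ > 0` (`= 1/2`) such
that for every single zero-spin tails-cut Kerr zone boosted to lab speed `≤ v₀`, every collar `η > 0` has
`t₁, C` with `∫_{x⁰ = t, r ≥ r₊ + ηM} Σ_μ(∂_μψ)² ≤ C·E[ψ](0)` for all `t ≥ t₁` and all smooth solutions `ψ` of the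
patched divergence-form wave equation on `{x⁰ ≥ 0}` outside the horizon. [cite: DafermosRodnianski2008, §3] -/
theorem singleZoneFarEnergyBound_zeroSpin : ∃ v₀ : ℝ, 0 < v₀ ∧ ∀ (M : Fin 1 → ℝ) (Λ : Fin 1 → lorentzGroup) (p : Fin 1 → E3) (u : Fin 1 → E4) (q : Fin 1 → E4 → E4), (∀ i, u i = (Λ i : E4 ≃L[ℝ] E4) (E4.basisVector 0)) → (∀ i x, q i x = poincareInv (Λ i) (E4.ofTimeSpace 0 (p i)) x) → (∀ i, 0 < M i) → (∀ i, 0 < u i 0 ∧ ‖E4.spatial (u i)‖ ≤ v₀ * u i 0) → ∀ (G : E4 → Fin 4 → Fin 4 → ℝ), (∀ x μ ν, G x μ ν = Minkowski.bilin (E4.basisVector μ) (E4.basisVector ν) - ∑ i, Real.smoothTransition (2 - Kerr.radius 0 (q i x) / (8 * M i)) * (2 * Kerr.scalarH (M i) 0 (q i x)) * ((Λ i : E4 ≃L[ℝ] E4) (Kerr.nullVector 0 (q i x))) μ * ((Λ i : E4 ≃L[ℝ] E4) (Kerr.nullVector 0 (q i x))) ν) → ∀ (E : (E4 → ℝ)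 → ℝ → ENNReal), (∀ φ t, E φ t = ∫⁻ y in {y : E3 | ∀ i, Kerr.rPlus (M i) 0 < Kerr.radius 0 (q i (E4.ofTimeSpace t y))}, ENNReal.ofReal (∑ μ : Fin 4, (fderiv ℝ φ (E4.ofTimeSpace t y) (E4.basisVector μ)) ^ 2)) → ∀ η : ℝ, 0 < η → ∃ (t₁ : ℝ) (C : NNReal), ∀ ψ : E4 → ℝ, ContDiff ℝ ∞ ψ → (∀ x : E4, 0 ≤ x 0 → (∀ i, Kerr.rPlus (M i) 0 < Kerr.radius 0 (q i x)) → ∑ μ : Fin 4, fderiv ℝ (fun y ↦ ∑ ν : Fin 4, G y μ ν * fderiv ℝ ψ y (E4.basisVector ν)) x (E4.basisVector μ) = 0) → ∀ t : ℝ, t₁ ≤ t → ∫⁻ y in {y : E3 | ∀ i, Kerr.rPlus (M i) 0 + η * M i ≤ Kerr.radius 0 (q i (E4.ofTimeSpace t y))}, ENNReal.ofReal (∑ μ : Fin 4, (fderiv ℝ ψ (E4.ofTimeSpace t y) (E4.basisVector μ)) ^ 2) ≤ (C : ENNReal) * E ψ 0 :=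
  singleZoneFarEnergyBound_zeroSpin_of_rest tailsCut_pullbackWave_single restFrame_farEnergyBound

end Summit.FinalStateConjecture.FinalStateConjecture.Theorems

end
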